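import Literature.MathematicalPhysics.QuantumFieldTheory.Balaban1983to89.T3AlphaInputsACTwoRunLevel
import Literature.MathematicalPhysics.QuantumFieldTheory.Balaban1983to89.T3Thresholds
import Summits.QuantumFields.YangMills.Theorems.UnitScaleTiltFluctuationComparisonRegPrPolymerBudget
import Summits.QuantumFields.YangMills.Theorems.UnitScaleTiltFluctuationComparisonRegPrLevelCauchyMinT
import Summits.QuantumFields.YangMills.Theorems.UnitScaleTiltFluctuationComparisonRegPrGlobalSlack

/-!
# `…GlobalSlackLocalToGlobal` — LOCAL ⇒ GLOBAL WITH KING'S SLACK: the PRODUCER half of STUB 3⁗ `stub_globalTwoRunSlackFam` (stmt-QuantumFields-19935; OWNER ym3-torus-plan g20-№11 (D), 10:51Z (i), 11:34Z)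
PORT, VERBATIM (§1–§4), of `Cruxes/FluctuationComparisonRegPr/Sketch_ideator1_g11.lean` (seat ym-cruxidea-19201-1 g11, F-idea1-g11-1; tree commit 9fe82ed0db4b, sha16 860438894ed220eb;
rc 0 · 0 sorry) into `…Theorems.GlobalSlackLocalToGlobal`, so that the 3⁗ lanes reduce the registered row `GlobalSlack.GlobalSupRateTSlack (dataOfV3 p π) b₀ p₀ a σ C` BY NAME to six
LOCAL per-polymer rows.  CREDIT: every declaration is ym-cruxidea-19201-1 g11's (`PolymerCauchyMinAtTSlack` is ideator 1 g9's §1); the porting seat (ym3-torus-p2 g14) changed only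
this docstring, the namespace and one theorem docstring; the PURE-FIRST entry (OWNER №11 ADDENDUM 3) is the sibling file `…GlobalSlackLocalToGlobalPure`.  CONTENT: `PintDecompTrivT D PT` ((43)) ∧
`LocCover D κ₁ C′` ∧ `LocBlockVolume D` ∧ `LocMatched D` ((45)–(46), (24)) ∧ `TermSizeTrivT D PT b₀ p₀ C_T κ₁` ((44), run `K+1`'s unmatched finest slice) ∧
`PolymerCauchyMinAtTSlack D PT b₀ p₀ κ₁ a σ C` (`0 < a < 1`) ⟹ `GlobalSupRateTSlack D b₀ p₀ a σ (max C′ 0 · (C_T + C/(1 − L^{a−1}) + C/(1 − L⁻¹)))`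
(`globalSupRateTSlack_of_polymerSlack`, PROVED, counting; `K`-UNIFORM constant: the budget's `L^{−4(k−i)}` ((44)) beats the domain count `#Site·L^{3(k−i)}` by `L^{−(k−i)}`,
so both pieces are geometric — `level_factor_geom_le`/`level_budget_geom_le`).  Nothing of [Balaban1985UV3]/[King1986] is asserted: rows are hypothesis schemas, theorems are counting.
References: [King1986] C. King, CMP 102 (1986) 649–677 (Thm 3.4 (3.9) p.656, (3.12)–(3.13) p.657); [Balaban1985UV3] T. Bałaban, CMP 102 (1985) 255–275 ((43)–(46), (57)). -/
set_option autoImplicit false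

noncomputable section

open scoped BigOperators
open Literature.MathematicalPhysics.QuantumFieldTheory.Balaban1983to89
open Literature.MathematicalPhysics.QuantumFieldTheory.Balaban1983to89.T3ContinuumYM3Torus
open Literature.MathematicalPhysics.QuantumFieldTheory.Balaban1983to89.T3UnitScaleTilt
open Literature.MathematicalPhysics.QuantumFieldTheory.Balaban1983to89.T3LevelShift
open Literature.MathematicalPhysics.QuantumFieldTheory.Balaban1983to89.T3AlphaInputsAC
open Literature.MathematicalPhysics.QuantumFieldTheory.Balaban1983to89.T3AlphaPolymerSocket
open Literature.MathematicalPhysics.QuantumFieldTheory.Balaban1983to89.T3AlphaInputsACTwoRun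
open Literature.MathematicalPhysics.QuantumFieldTheory.Balaban1983to89.T3AlphaInputsACTwoRunLevel
open Literature.MathematicalPhysics.QuantumFieldTheory.Balaban1983to89.T3Thresholds
open Summit.QuantumFields.YangMills.Theorems.LogComparisonPolymerBudget
  (card_site_zero sum_exp_le inv_pow_pow_eq_rpow inv_pow_rpow_eq_rpow extra_budget_le)
open Summit.QuantumFields.YangMills.Theorems.LogComparisonLevelCauchyMinT (levelDataT PintH_eq_sum_levelDataT)
open Summit.QuantumFields.YangMills.Theorems.GlobalSlack (GlobalSupRateTSlack)

namespace Summit.QuantumFields.YangMills.Theorems.GlobalSlackLocalToGlobal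

variable {F : T3Family} {γ : ℝ}

/-! ## §1 The two rows: the global one BY NAME from `Theorems.GlobalSlack` (landed port of sketch g10), the per-polymer one verbatim from sketch g9 -/

section Defs

variable (D : AlphaDataT3 F γ)

/- **THE GLOBAL TWO-RUN BOUND WITH KING'S ADDITIVE SLACK** is used BY NAME from the landed port: `GlobalSlack.GlobalSupRateTSlack D b₀ p₀ a σ C` :=
`∃ c, ∀ K n, n ≤ K → ∀ V, PlaqSmall (θ(n)) V → |PintH (K+1) n V − PintH K n V − c K n| ≤ C·#Site(F.P n)·(θ(n)²·((L^{K−n})⁻¹)^a + θ(n)^σ)` (F-idea1-g10-1; 3⁗'s row).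
[cite: King1986, Thm 3.4 (3.9) p.656] -/

/-- **THE PER-POLYMER TWO-CUT-OFF ROW WITH KING'S SLACK** (hypothesis schema, never asserted; VERBATIM `Sketch_ideator1_g9` §1): `PolymerCauchyMinAtT` with the
per-polymer budget `C·e^{−κ₁𝓛}·L^{−4(K−n−1−j)}·(θ(n)²·(L^{−(1+j)})^a + θ(n)^σ)`. [cite: King1986, Thm 3.4 (3.9) p.656; Balaban1985UV3, (44) p.267] -/
def PolymerCauchyMinAtTSlack (PT : TermFn F) (b₀ p₀ κ₁ a : ℝ) (σ : ℕ) (C : ℝ) : Prop :=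
  ∃ c : (K n j : ℕ) → Set (Site (F.P K) 0) → ℝ,
    ∀ (K n : ℕ) (h : n ≤ K), ∀ j : ℕ, j < K - n →
      ∀ V : GaugeField (F.P n) 0 (Matrix.specialUnitaryGroup (Fin 2) ℂ), PlaqSmall (θBal F.L γ b₀ p₀ n) V →
        ∀ Y ∈ D.Loc K (K - n) (D.triv K (K - n)) (1 + j),
          |PT (K + 1) (K + 1 - n) (1 + (j + 1)) (refineSet F K Y)
              (fieldShift (F.sitesPerDir_eq (m := F.m) (K := K + 1) (j := K + 1 - n) (m' := F.m) (K' := n) (j' := 0) (by omega)) V) -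
            PT K (K - n) (1 + j) Y
              (fieldShift (F.sitesPerDir_eq (m := F.m) (K := K) (j := K - n) (m' := F.m) (K' := n) (j' := 0) (by omega)) V) -
            c K n j Y| ≤
          C * Real.exp (-κ₁ * D.treeLen K (1 + j) Y) * (((F.L : ℝ) ^ (K - n - 1 - j))⁻¹) ^ 4 *
            (θBal F.L γ b₀ p₀ n ^ 2 * (((F.L : ℝ) ^ (1 + j))⁻¹) ^ a + θBal F.L γ b₀ p₀ n ^ σ)

end Defs

/-! ## §1b The same two rows with a GENERIC rate weight `w n` in place of `θ(n)²` (covers the owner's pre-authorised fallback of RULING №11 ADDENDUM: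
`w n := L^{βn}`, `β ≥ 0`, given the one-line check `θ(n+1)² ≤ w n`) -/

section WDefs

variable (D : AlphaDataT3 F γ)

/-- `GlobalSupRateTSlack` with the rate half weighted by a generic `w n ≥ 0` instead of `θ(n)²` (hypothesis schema, never asserted):
`|PintH (K+1) n V − PintH K n V − c K n| ≤ C·#Site(F.P n)·(w(n)·L^{−a(K−n)} + θ(n)^σ)`. [cite: King1986, Thm 3.4 (3.9) p.656 and (3.12) p.657] -/
def GlobalSupRateWSlack (b₀ p₀ : ℝ) (w : ℕ → ℝ) (a : ℝ) (σ : ℕ) (C : ℝ) : Prop :=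
  ∃ c : ℕ → ℕ → ℝ, ∀ (K n : ℕ), n ≤ K → ∀ V : GaugeField (F.P n) 0 (Matrix.specialUnitaryGroup (Fin 2) ℂ), PlaqSmall (θBal F.L γ b₀ p₀ n) V →
    |D.PintH (K + 1) n V - D.PintH K n V - c K n| ≤
      C * (Fintype.card (Site (F.P n) 0) : ℝ) * (w n * (((F.L : ℝ) ^ (K - n))⁻¹) ^ a + θBal F.L γ b₀ p₀ n ^ σ)

/-- `PolymerCauchyMinAtTSlack` with the rate half weighted by a generic `w n` instead of `θ(n)²` (hypothesis schema, never asserted).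
[cite: King1986, Thm 3.4 (3.9) p.656; Balaban1985UV3, (44) p.267] -/
def PolymerCauchyMinAtWSlack (PT : TermFn F) (b₀ p₀ κ₁ : ℝ) (w : ℕ → ℝ) (a : ℝ) (σ : ℕ) (C : ℝ) : Prop :=
  ∃ c : (K n j : ℕ) → Set (Site (F.P K) 0) → ℝ,
    ∀ (K n : ℕ) (h : n ≤ K), ∀ j : ℕ, j < K - n →
      ∀ V : GaugeField (F.P n) 0 (Matrix.specialUnitaryGroup (Fin 2) ℂ), PlaqSmall (θBal F.L γ b₀ p₀ n) V →
        ∀ Y ∈ D.Loc K (K - n) (D.triv K (K - n)) (1 + j),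
          |PT (K + 1) (K + 1 - n) (1 + (j + 1)) (refineSet F K Y)
              (fieldShift (F.sitesPerDir_eq (m := F.m) (K := K + 1) (j := K + 1 - n) (m' := F.m) (K' := n) (j' := 0) (by omega)) V) -
            PT K (K - n) (1 + j) Y
              (fieldShift (F.sitesPerDir_eq (m := F.m) (K := K) (j := K - n) (m' := F.m) (K' := n) (j' := 0) (by omega)) V) -
            c K n j Y| ≤
          C * Real.exp (-κ₁ * D.treeLen K (1 + j) Y) * (((F.L : ℝ) ^ (K - n - 1 - j))⁻¹) ^ 4 *
            (w n * (((F.L : ℝ) ^ (1 + j))⁻¹) ^ a + θBal F.L γ b₀ p₀ n ^ σ)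

/-- The verbatim global row is the `w n := θ(n)²` instance of the generic one (definitional). -/
theorem globalSupRateTSlack_iff_W (b₀ p₀ a : ℝ) (σ : ℕ) (C : ℝ) :
    GlobalSupRateTSlack D b₀ p₀ a σ C ↔ GlobalSupRateWSlack D b₀ p₀ (fun n => θBal F.L γ b₀ p₀ n ^ 2) a σ C :=
  Iff.rfl

/-- The verbatim per-polymer row is the `w n := θ(n)²` instance of the generic one (definitional). -/
theorem polymerCauchyMinAtTSlack_iff_W (PT : TermFn F) (b₀ p₀ κ₁ a : ℝ) (σ : ℕ) (C : ℝ) :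
    PolymerCauchyMinAtTSlack D PT b₀ p₀ κ₁ a σ C ↔ PolymerCauchyMinAtWSlack D PT b₀ p₀ κ₁ (fun n => θBal F.L γ b₀ p₀ n ^ 2) a σ C :=
  Iff.rfl

end WDefs

/-! ## §2 Counting with the geometric margin kept -/

/-- **THE LEVEL EXPONENT WITH THE MARGIN**: for `i ≤ k`, `K = n + k` and any real `b`,
`x^{3(m_F+K)}·((x^{k−i})⁻¹)^4·((x^{i})⁻¹)^b / x^{3i} ≤ x^{3m_F}·x^{3n − b·k}·(x^{b−1})^{k−i}` (`1 < x`; in fact an equality of exponents — the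
tree's `level_factor_le` drops the last factor). [cite: King1986, (3.12)-(3.13) p.657] -/
theorem level_factor_geom_le {x : ℝ} (hx : 1 < x) (mF : ℕ) {K n k i : ℕ} (hK : K = n + k) (hik : i ≤ k) (b : ℝ) :
    x ^ (3 * (mF + K)) * ((x ^ (k - i))⁻¹) ^ 4 * ((x ^ i)⁻¹) ^ b / x ^ (3 * i) ≤
      x ^ (3 * mF) * x ^ ((3 * n - b * k : ℝ)) * (x ^ (b - 1)) ^ (k - i) := by
  have hx0 : 0 < x := by linarith
  rw [inv_pow_pow_eq_rpow hx0, inv_pow_rpow_eq_rpow hx0, ← Real.rpow_natCast x (3 * (mF + K)), ← Real.rpow_natCast x (3 * i),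
    ← Real.rpow_natCast x (3 * mF), ← Real.rpow_natCast (x ^ (b - 1)) (k - i), ← Real.rpow_mul hx0.le,
    div_eq_mul_inv, ← Real.rpow_neg hx0.le, ← Real.rpow_add hx0, ← Real.rpow_add hx0,
    ← Real.rpow_add hx0, ← Real.rpow_add hx0, ← Real.rpow_add hx0]
  refine Real.rpow_le_rpow_of_exponent_le hx.le (le_of_eq ?_)
  have hki : ((k - i : ℕ) : ℝ) = (k : ℝ) - i := by rw [Nat.cast_sub hik]
  push_cast
  rw [hK, hki]
  push_cast
  ring

/-- **ONE LEVEL, MARGIN KEPT**: for `n ≤ K`, `j < K − n`, `0 ≤ M₀` and any real `b`,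
`Σ_{Y ∈ Loc K (K−n) h (1+j)} M₀·e^{−κ₁𝓛(Y)}·((L^{K−n−1−j})⁻¹)^4·((L^{1+j})⁻¹)^b ≤ 8M₀·max(C′,0)·L^{3m_F}·L^{3n − b(K−n)}·(L^{b−1})^{K−n−1−j}`.
[cite: Balaban1985UV3, (45)-(46) p.267; King1986, (3.12)-(3.13) p.657] -/
theorem level_budget_geom_le {D : AlphaDataT3 F γ} {κ₁ C' : ℝ} (hLC : LocCover D κ₁ C') (hBV : LocBlockVolume D) {M₀ : ℝ} (hM : 0 ≤ M₀)
    (b : ℝ) {K n : ℕ} (hn : n ≤ K) (h : D.Hist K (K - n)) {j : ℕ} (hj : j < K - n) :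
    ∑ Y ∈ D.Loc K (K - n) h (1 + j), M₀ * Real.exp (-κ₁ * D.treeLen K (1 + j) Y) * (((F.L : ℝ) ^ (K - n - 1 - j))⁻¹) ^ 4 *
        (((F.L : ℝ) ^ (1 + j))⁻¹) ^ b ≤
      8 * M₀ * max C' 0 * (F.L : ℝ) ^ (3 * F.m) * (F.L : ℝ) ^ ((3 * n - b * (K - n : ℕ) : ℝ)) *
        ((F.L : ℝ) ^ (b - 1)) ^ (K - n - 1 - j) := by
  have hL : (1 : ℝ) < (F.L : ℝ) := by exact_mod_cast F.hL.2
  have hL0 : (0 : ℝ) < (F.L : ℝ) := by linarith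
  have hki : K - n - 1 - j = (K - n) - (1 + j) := by omega
  have hfac : ∀ Y, M₀ * Real.exp (-κ₁ * D.treeLen K (1 + j) Y) * (((F.L : ℝ) ^ (K - n - 1 - j))⁻¹) ^ 4 * (((F.L : ℝ) ^ (1 + j))⁻¹) ^ b =
      (M₀ * (((F.L : ℝ) ^ (K - n - 1 - j))⁻¹) ^ 4 * (((F.L : ℝ) ^ (1 + j))⁻¹) ^ b) * Real.exp (-κ₁ * D.treeLen K (1 + j) Y) :=
    fun Y => by ring
  simp_rw [hfac]
  rw [← Finset.mul_sum]
  have hcoef : 0 ≤ M₀ * (((F.L : ℝ) ^ (K - n - 1 - j))⁻¹) ^ 4 * (((F.L : ℝ) ^ (1 + j))⁻¹) ^ b := by positivity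
  refine (mul_le_mul_of_nonneg_left (sum_exp_le D hLC hBV K (K - n) h (1 + j)) hcoef).trans ?_
  have hlev := level_factor_geom_le hL F.m (K := K) (n := n) (k := K - n) (i := 1 + j) (by omega) (by omega) b
  rw [hki]
  have hC : 0 ≤ max C' 0 := le_max_right _ _
  calc M₀ * (((F.L : ℝ) ^ (K - n - (1 + j)))⁻¹) ^ 4 * (((F.L : ℝ) ^ (1 + j))⁻¹) ^ b *
        (max C' 0 * 8 * (F.L : ℝ) ^ (3 * (F.m + K)) / (F.L : ℝ) ^ (3 * (1 + j)))
      = 8 * M₀ * max C' 0 * ((F.L : ℝ) ^ (3 * (F.m + K)) * (((F.L : ℝ) ^ (K - n - (1 + j)))⁻¹) ^ 4 *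
          (((F.L : ℝ) ^ (1 + j))⁻¹) ^ b / (F.L : ℝ) ^ (3 * (1 + j))) := by ring
    _ ≤ 8 * M₀ * max C' 0 * ((F.L : ℝ) ^ (3 * F.m) * (F.L : ℝ) ^ ((3 * n - b * (K - n : ℕ) : ℝ)) *
          ((F.L : ℝ) ^ (b - 1)) ^ (K - n - (1 + j))) :=
        mul_le_mul_of_nonneg_left hlev (by positivity)
    _ = _ := by ring

/-- `8·L^{3m_F}·L^{3n − b(K−n)} = #Site(F.P n)·((L^{K−n})⁻¹)^b`: the level budget in the letters of the global row. [cite: Balaban1987RG1, (0.1) p.251] -/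
theorem eight_pow_eq_card_mul (F : T3Family) (b : ℝ) (K n : ℕ) :
    8 * (F.L : ℝ) ^ (3 * F.m) * (F.L : ℝ) ^ ((3 * n - b * (K - n : ℕ) : ℝ)) =
      (Fintype.card (Site (F.P n) 0) : ℝ) * (((F.L : ℝ) ^ (K - n))⁻¹) ^ b := by
  have hL : (1 : ℝ) < (F.L : ℝ) := by exact_mod_cast F.hL.2
  have hL0 : (0 : ℝ) < (F.L : ℝ) := by linarith
  have hsplit : ((3 * n - b * (K - n : ℕ) : ℝ)) = ((3 * n : ℕ) : ℝ) + -(b * ((K - n : ℕ) : ℝ)) := by push_cast; ring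
  rw [card_site_zero, inv_pow_rpow_eq_rpow hL0, hsplit, Real.rpow_add hL0, Real.rpow_natCast]
  ring

/-- The geometric sum along the levels: `Σ_{j<k} r^{k−1−j} ≤ 1/(1−r)` for `0 ≤ r < 1`. [folklore] -/
theorem sum_reflect_geom_le {r : ℝ} (hr0 : 0 ≤ r) (hr1 : r < 1) (k : ℕ) :
    ∑ j ∈ Finset.range k, r ^ (k - 1 - j) ≤ 1 / (1 - r) := by
  rw [Finset.sum_range_reflect (fun j => r ^ j) k, Finset.range_eq_Ico]
  simpa using geom_sum_Ico_le_of_lt_one (m := 0) (n := k) hr0 hr1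

/-! ## §3 The matched levels: one level's two-run difference is the sum of the per-domain differences -/

/-- **MATCHED LEVEL DIFFERENCE**: under `LocMatched D`, for `n ≤ K`, `j < K − n` and any per-domain shifts `c`,
`levelDataT (K+1) (j+1) n V − levelDataT K j n V − Σ_Y c Y = Σ_{Y ∈ Loc K (K−n) triv (1+j)} (PT′(refine Y) − PT(Y) − c Y)` (refinement is a
bijection of the listed domains). [cite: Balaban1985UV3, (24) p.262 and (43) p.266] -/
theorem levelDataT_succ_sub {D : AlphaDataT3 F γ} (PT : TermFn F) (hLM : LocMatched D) {K n : ℕ} (hn : n ≤ K) {j : ℕ}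
    (hj : j < K - n) (V : GaugeField (F.P n) 0 (Matrix.specialUnitaryGroup (Fin 2) ℂ)) (c : Set (Site (F.P K) 0) → ℝ) :
    levelDataT D PT (K + 1) (j + 1) n V - levelDataT D PT K j n V - ∑ Y ∈ D.Loc K (K - n) (D.triv K (K - n)) (1 + j), c Y =
      ∑ Y ∈ D.Loc K (K - n) (D.triv K (K - n)) (1 + j),
        (PT (K + 1) (K + 1 - n) (1 + (j + 1)) (refineSet F K Y)
            (fieldShift (F.sitesPerDir_eq (m := F.m) (K := K + 1) (j := K + 1 - n) (m' := F.m) (K' := n) (j' := 0) (by omega)) V) -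
          PT K (K - n) (1 + j) Y
            (fieldShift (F.sitesPerDir_eq (m := F.m) (K := K) (j := K - n) (m' := F.m) (K' := n) (j' := 0) (by omega)) V) -
          c Y) := by
  have hle : n ≤ K + 1 := hn.trans (Nat.le_succ K)
  have hbij := hLM K n hn (1 + j) (by omega) (by omega)
  have hldK : levelDataT D PT K j n V = ∑ Y ∈ D.Loc K (K - n) (D.triv K (K - n)) (1 + j), PT K (K - n) (1 + j) Y
      (fieldShift (F.sitesPerDir_eq (m := F.m) (K := K) (j := K - n) (m' := F.m) (K' := n) (j' := 0) (by omega)) V) := by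
    simp only [levelDataT, dif_pos hn]
  have hldK1 : levelDataT D PT (K + 1) (j + 1) n V =
      ∑ Y' ∈ D.Loc (K + 1) (K + 1 - n) (D.triv (K + 1) (K + 1 - n)) (1 + (j + 1)),
        PT (K + 1) (K + 1 - n) (1 + (j + 1)) Y'
          (fieldShift (F.sitesPerDir_eq (m := F.m) (K := K + 1) (j := K + 1 - n) (m' := F.m) (K' := n) (j' := 0) (by omega)) V) := by
    simp only [levelDataT, dif_pos hle]
  have hsum : ∑ Y' ∈ D.Loc (K + 1) (K + 1 - n) (D.triv (K + 1) (K + 1 - n)) (1 + (j + 1)),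
        PT (K + 1) (K + 1 - n) (1 + (j + 1)) Y'
          (fieldShift (F.sitesPerDir_eq (m := F.m) (K := K + 1) (j := K + 1 - n) (m' := F.m) (K' := n) (j' := 0) (by omega)) V) =
      ∑ Y ∈ D.Loc K (K - n) (D.triv K (K - n)) (1 + j), PT (K + 1) (K + 1 - n) (1 + (j + 1)) (refineSet F K Y)
          (fieldShift (F.sitesPerDir_eq (m := F.m) (K := K + 1) (j := K + 1 - n) (m' := F.m) (K' := n) (j' := 0) (by omega)) V) := by
    symm
    exact Finset.sum_nbij (refineSet F K) (fun Y hY => hbij.mapsTo hY) (fun Y₁ h₁ Y₂ h₂ h12 => hbij.injOn h₁ h₂ h12)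
      (fun Y' hY' => hbij.surjOn hY') (fun Y _ => rfl)
  rw [hldK, hldK1, hsum, ← Finset.sum_sub_distrib, ← Finset.sum_sub_distrib]

/-! ## §4 LOCAL ⇒ GLOBAL WITH THE SLACK (the producer-side composition for STUB 3⁗) -/

/-- **THE GLOBAL SLACK ROW FROM THE PER-POLYMER SLACK ROW, GENERIC RATE WEIGHT** (PROVED; pure counting): for `0 < γ ≤ 1`, `0 < b₀` (only to know
`θ(n) ≥ 0`), a weight `w n ≥ 0` dominating `θ(n+1)²` (the size (44) of run `K+1`'s unmatched finest slice carries `θ(n+1)²`), `0 < a < 1`, `0 ≤ C`,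
`0 ≤ C_T`: the (43)-decomposition over a term function, summable ∕ block-volume ∕ matched localisation domains at the row's decay rate `κ₁`, the printed
size (44) of the terms and the per-polymer two-cut-off row with King's slack give the GLOBAL row with slack at the same `w`, `a`, `σ` and the
`K`-UNIFORM constant `max(C′,0)·(C_T + C/(1 − L^{a−1}) + C/(1 − L⁻¹))`. [cite: King1986, Thm 3.4 (3.9) p.656 and (3.12)-(3.13) p.657; Balaban1985UV3,
(43)-(46) pp.266-267] -/
theorem globalSupRateWSlack_of_polymerWSlack {D : AlphaDataT3 F γ} {PT : TermFn F} {b₀ p₀ κ₁ a C C_T C' : ℝ} {σ : ℕ} {w : ℕ → ℝ}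
    (hγ : 0 < γ) (hγ1 : γ ≤ 1) (hb : 0 < b₀) (hw0 : ∀ n, 0 ≤ w n) (hw : ∀ n, θBal F.L γ b₀ p₀ (n + 1) ^ 2 ≤ w n)
    (ha : 0 < a) (ha1 : a < 1) (hC : 0 ≤ C) (hCT : 0 ≤ C_T)
    (hdec : PintDecompTrivT D PT) (hLC : LocCover D κ₁ C') (hBV : LocBlockVolume D) (hLM : LocMatched D)
    (hTS : TermSizeTrivT D PT b₀ p₀ C_T κ₁) (hPC : PolymerCauchyMinAtWSlack D PT b₀ p₀ κ₁ w a σ C) :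
    GlobalSupRateWSlack D b₀ p₀ w a σ
      (max C' 0 * (C_T + C / (1 - (F.L : ℝ) ^ (a - 1)) + C / (1 - (F.L : ℝ)⁻¹))) := by
  classical
  obtain ⟨c, hc⟩ := hPC
  obtain ⟨_, hts⟩ := hTS
  have hLn : 1 ≤ F.L := F.hL.2.le
  have hL : (1 : ℝ) < (F.L : ℝ) := by exact_mod_cast F.hL.2
  have hL0 : (0 : ℝ) < (F.L : ℝ) := by linarith
  -- the two geometric ratios
  set ra : ℝ := (F.L : ℝ) ^ (a - 1) with hra_def
  set r0 : ℝ := (F.L : ℝ)⁻¹ with hr0_def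
  have hra0 : 0 ≤ ra := (Real.rpow_pos_of_pos hL0 _).le
  have hra1 : ra < 1 := Real.rpow_lt_one_of_one_lt_of_neg hL (by linarith)
  have hr00 : 0 ≤ r0 := (inv_pos.mpr hL0).le
  have hr01 : r0 < 1 := inv_lt_one_of_one_lt₀ hL
  have hθ : ∀ i, 0 ≤ θBal F.L γ b₀ p₀ i := fun i => (T3MinimiserStabilityReduction.θBal_pos hLn hγ hγ1 hb p₀ i).le
  have hC' : 0 ≤ max C' 0 := le_max_right _ _
  have hTa : 0 ≤ C / (1 - ra) := div_nonneg hC (by linarith)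
  have hT0 : 0 ≤ C / (1 - r0) := div_nonneg hC (by linarith)
  refine ⟨fun K n => ∑ j ∈ Finset.range (K - n), ∑ Y ∈ D.Loc K (K - n) (D.triv K (K - n)) (1 + j), c K n j Y, ?_⟩
  intro K n hn V hV
  have hle : n ≤ K + 1 := hn.trans (Nat.le_succ K)
  set θ := θBal F.L γ b₀ p₀ n with hθ_def
  set N : ℝ := (Fintype.card (Site (F.P n) 0) : ℝ) with hN_def
  have hN0 : 0 ≤ N := by positivity
  set La : ℝ := (((F.L : ℝ) ^ (K - n))⁻¹) ^ a with hLa_def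
  have hLa0 : 0 ≤ La := by positivity
  have hθn : 0 ≤ θ := hθ n
  have hθσ : 0 ≤ θ ^ σ := pow_nonneg hθn σ
  have hwn : 0 ≤ w n := hw0 n
  -- §4(1) the two height readings, decomposed by steps
  have hK1 : K + 1 - n = (K - n) + 1 := by omega
  have hP1 : D.PintH (K + 1) n V =
      (∑ j ∈ Finset.range (K - n), levelDataT D PT (K + 1) (j + 1) n V) + levelDataT D PT (K + 1) 0 n V := by
    rw [PintH_eq_sum_levelDataT D PT hdec, hK1, Finset.sum_range_succ']
  have hP0 : D.PintH K n V = ∑ j ∈ Finset.range (K - n), levelDataT D PT K j n V := PintH_eq_sum_levelDataT D PT hdec K n V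
  have hdiff : D.PintH (K + 1) n V - D.PintH K n V -
        ∑ j ∈ Finset.range (K - n), ∑ Y ∈ D.Loc K (K - n) (D.triv K (K - n)) (1 + j), c K n j Y =
      levelDataT D PT (K + 1) 0 n V +
        ∑ j ∈ Finset.range (K - n), (levelDataT D PT (K + 1) (j + 1) n V - levelDataT D PT K j n V -
          ∑ Y ∈ D.Loc K (K - n) (D.triv K (K - n)) (1 + j), c K n j Y) := by
    rw [hP1, hP0, Finset.sum_sub_distrib, Finset.sum_sub_distrib]
    ring
  rw [hdiff]
  -- §4(2) the unmatched finest slice of run `K+1` (size IS a rate): (44) at run K+1, level 1; (45)-(46); then θ(n+1)² ≤ w n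
  have hKn : K + 1 - n - 1 = K - n := by omega
  have hextra : |levelDataT D PT (K + 1) 0 n V| ≤ max C' 0 * C_T * N * (w n * La) := by
    have hld : levelDataT D PT (K + 1) 0 n V = ∑ Y ∈ D.Loc (K + 1) (K + 1 - n) (D.triv (K + 1) (K + 1 - n)) 1,
        PT (K + 1) (K + 1 - n) 1 Y
          (fieldShift (F.sitesPerDir_eq (m := F.m) (K := K + 1) (j := K + 1 - n) (m' := F.m) (K' := n) (j' := 0) (by omega)) V) := by
      simp only [levelDataT, dif_pos hle, Nat.add_zero]
    rw [hld]
    have h1 : ∀ Y ∈ D.Loc (K + 1) (K + 1 - n) (D.triv (K + 1) (K + 1 - n)) 1,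
        |PT (K + 1) (K + 1 - n) 1 Y
            (fieldShift (F.sitesPerDir_eq (m := F.m) (K := K + 1) (j := K + 1 - n) (m' := F.m) (K' := n) (j' := 0) (by omega)) V)| ≤
          C_T * Real.exp (-κ₁ * D.treeLen (K + 1) 1 Y) * θBal F.L γ b₀ p₀ (n + 1) ^ 2 * (((F.L : ℝ) ^ (K - n))⁻¹) ^ 4 := by
      intro Y hY
      have h := hts (K + 1) n hle V hV 1 le_rfl (by omega) Y hY
      rw [hKn] at h
      exact h
    refine (Finset.abs_sum_le_sum_abs _ _).trans ((Finset.sum_le_sum h1).trans ?_)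
    refine (extra_budget_le D hLC hBV hCT ha1.le hn (D.triv (K + 1) (K + 1 - n))).trans ?_
    rw [show 8 * C_T * max C' 0 * θBal F.L γ b₀ p₀ (n + 1) ^ 2 * (F.L : ℝ) ^ (3 * F.m) * (F.L : ℝ) ^ ((3 * n - a * (K - n : ℕ) : ℝ)) =
        C_T * max C' 0 * θBal F.L γ b₀ p₀ (n + 1) ^ 2 * (8 * (F.L : ℝ) ^ (3 * F.m) * (F.L : ℝ) ^ ((3 * n - a * (K - n : ℕ) : ℝ))) by ring,
      eight_pow_eq_card_mul F a K n]
    have hNL : 0 ≤ C_T * max C' 0 * (N * La) := by positivity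
    calc C_T * max C' 0 * θBal F.L γ b₀ p₀ (n + 1) ^ 2 * ((Fintype.card (Site (F.P n) 0) : ℝ) * (((F.L : ℝ) ^ (K - n))⁻¹) ^ a)
        = (C_T * max C' 0 * (N * La)) * θBal F.L γ b₀ p₀ (n + 1) ^ 2 := by ring
      _ ≤ (C_T * max C' 0 * (N * La)) * w n := mul_le_mul_of_nonneg_left (hw n) hNL
      _ = max C' 0 * C_T * N * (w n * La) := by ring
  -- §4(3) one matched level: the per-polymer slack row summed over the level's domains, margin kept
  have hlevel : ∀ j ∈ Finset.range (K - n),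
      |levelDataT D PT (K + 1) (j + 1) n V - levelDataT D PT K j n V -
          ∑ Y ∈ D.Loc K (K - n) (D.triv K (K - n)) (1 + j), c K n j Y| ≤
        w n * (C * max C' 0 * N * La) * ra ^ (K - n - 1 - j) + θ ^ σ * (C * max C' 0 * N) * r0 ^ (K - n - 1 - j) := by
    intro j hj
    rw [Finset.mem_range] at hj
    rw [levelDataT_succ_sub PT hLM hn hj V (c K n j)]
    refine (Finset.abs_sum_le_sum_abs _ _).trans ?_
    refine (Finset.sum_le_sum fun Y hY => hc K n hn j hj V hV Y hY).trans ?_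
    -- split the summand into the rate piece (b = a) and the slack piece (b = 0)
    have hsplit : ∀ Y, C * Real.exp (-κ₁ * D.treeLen K (1 + j) Y) * (((F.L : ℝ) ^ (K - n - 1 - j))⁻¹) ^ 4 *
          (w n * (((F.L : ℝ) ^ (1 + j))⁻¹) ^ a + θBal F.L γ b₀ p₀ n ^ σ) =
        w n * (C * Real.exp (-κ₁ * D.treeLen K (1 + j) Y) * (((F.L : ℝ) ^ (K - n - 1 - j))⁻¹) ^ 4 *
            (((F.L : ℝ) ^ (1 + j))⁻¹) ^ a) +
          θ ^ σ * (C * Real.exp (-κ₁ * D.treeLen K (1 + j) Y) * (((F.L : ℝ) ^ (K - n - 1 - j))⁻¹) ^ 4 *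
            (((F.L : ℝ) ^ (1 + j))⁻¹) ^ (0 : ℝ)) := by
      intro Y
      rw [Real.rpow_zero]
      ring
    simp_rw [hsplit]
    rw [Finset.sum_add_distrib, ← Finset.mul_sum, ← Finset.mul_sum]
    have hA := level_budget_geom_le (D := D) hLC hBV hC a hn (D.triv K (K - n)) hj
    have hB := level_budget_geom_le (D := D) hLC hBV hC (0 : ℝ) hn (D.triv K (K - n)) hj
    -- rewrite the two level budgets in the letters of the global row
    have hA' : 8 * C * max C' 0 * (F.L : ℝ) ^ (3 * F.m) * (F.L : ℝ) ^ ((3 * n - a * (K - n : ℕ) : ℝ)) *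
          ((F.L : ℝ) ^ (a - 1)) ^ (K - n - 1 - j) = (C * max C' 0 * N * La) * ra ^ (K - n - 1 - j) := by
      rw [show 8 * C * max C' 0 * (F.L : ℝ) ^ (3 * F.m) * (F.L : ℝ) ^ ((3 * n - a * (K - n : ℕ) : ℝ)) =
          C * max C' 0 * (8 * (F.L : ℝ) ^ (3 * F.m) * (F.L : ℝ) ^ ((3 * n - a * (K - n : ℕ) : ℝ))) by ring,
        eight_pow_eq_card_mul F a K n]
      ring
    have hB' : 8 * C * max C' 0 * (F.L : ℝ) ^ (3 * F.m) * (F.L : ℝ) ^ ((3 * n - (0 : ℝ) * (K - n : ℕ) : ℝ)) *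
          ((F.L : ℝ) ^ ((0 : ℝ) - 1)) ^ (K - n - 1 - j) = (C * max C' 0 * N) * r0 ^ (K - n - 1 - j) := by
      rw [show 8 * C * max C' 0 * (F.L : ℝ) ^ (3 * F.m) * (F.L : ℝ) ^ ((3 * n - (0 : ℝ) * (K - n : ℕ) : ℝ)) =
          C * max C' 0 * (8 * (F.L : ℝ) ^ (3 * F.m) * (F.L : ℝ) ^ ((3 * n - (0 : ℝ) * (K - n : ℕ) : ℝ))) by ring,
        eight_pow_eq_card_mul F 0 K n, Real.rpow_zero, zero_sub, Real.rpow_neg_one]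
      ring
    rw [hA'] at hA
    rw [hB'] at hB
    refine (add_le_add (mul_le_mul_of_nonneg_left hA hwn) (mul_le_mul_of_nonneg_left hB hθσ)).trans_eq ?_
    ring
  -- §4(4) sum over the levels: geometric series in both pieces
  have hsumA : ∑ j ∈ Finset.range (K - n), ra ^ (K - n - 1 - j) ≤ 1 / (1 - ra) := sum_reflect_geom_le hra0 hra1 (K - n)
  have hsum0 : ∑ j ∈ Finset.range (K - n), r0 ^ (K - n - 1 - j) ≤ 1 / (1 - r0) := sum_reflect_geom_le hr00 hr01 (K - n)
  have hmatched : |∑ j ∈ Finset.range (K - n), (levelDataT D PT (K + 1) (j + 1) n V - levelDataT D PT K j n V -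
          ∑ Y ∈ D.Loc K (K - n) (D.triv K (K - n)) (1 + j), c K n j Y)| ≤
      w n * (C * max C' 0 * N * La) * (1 / (1 - ra)) + θ ^ σ * (C * max C' 0 * N) * (1 / (1 - r0)) := by
    refine (Finset.abs_sum_le_sum_abs _ _).trans ((Finset.sum_le_sum hlevel).trans ?_)
    rw [Finset.sum_add_distrib, ← Finset.mul_sum, ← Finset.mul_sum]
    have hcA : 0 ≤ w n * (C * max C' 0 * N * La) := mul_nonneg hwn (by positivity)
    have hc0 : 0 ≤ θ ^ σ * (C * max C' 0 * N) := mul_nonneg hθσ (by positivity)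
    exact add_le_add (mul_le_mul_of_nonneg_left hsumA hcA) (mul_le_mul_of_nonneg_left hsum0 hc0)
  -- §4(5) assemble
  refine (abs_add_le _ _).trans ((add_le_add hextra hmatched).trans ?_)
  have hkey : max C' 0 * C_T * N * (w n * La) + (w n * (C * max C' 0 * N * La) * (1 / (1 - ra)) +
        θ ^ σ * (C * max C' 0 * N) * (1 / (1 - r0))) =
      max C' 0 * N * ((C_T + C / (1 - ra)) * (w n * La) + (C / (1 - r0)) * θ ^ σ) := by
    ring
  rw [hkey]
  have hT1 : C_T + C / (1 - ra) ≤ C_T + C / (1 - ra) + C / (1 - r0) := le_add_of_nonneg_right hT0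
  have hT2 : C / (1 - r0) ≤ C_T + C / (1 - ra) + C / (1 - r0) := by linarith
  have hin : (C_T + C / (1 - ra)) * (w n * La) + (C / (1 - r0)) * θ ^ σ ≤
      (C_T + C / (1 - ra) + C / (1 - r0)) * (w n * La + θ ^ σ) := by
    rw [mul_add]
    exact add_le_add (mul_le_mul_of_nonneg_right hT1 (mul_nonneg hwn hLa0)) (mul_le_mul_of_nonneg_right hT2 hθσ)
  calc max C' 0 * N * ((C_T + C / (1 - ra)) * (w n * La) + (C / (1 - r0)) * θ ^ σ)
      ≤ max C' 0 * N * ((C_T + C / (1 - ra) + C / (1 - r0)) * (w n * La + θ ^ σ)) :=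
        mul_le_mul_of_nonneg_left hin (mul_nonneg hC' hN0)
    _ = _ := by ring

/-- **`GlobalSupRateTSlack` FROM THE PER-POLYMER SLACK ROW — THE VERBATIM 3⁗ LETTERS** (PROVED): the `w n := θ(n)²` instance; the domination
`θ(n+1)² ≤ θ(n)²` is the monotonicity of the thresholds (`T3Thresholds.θBal_succ_le`) on the window `√γ ≤ e^{1−p₀}`, `0 ≤ p₀`.
[cite: King1986, Thm 3.4 (3.9) p.656 and (3.12)-(3.13) p.657; Balaban1985UV3, (43)-(46) pp.266-267] -/
theorem globalSupRateTSlack_of_polymerSlack {D : AlphaDataT3 F γ} {PT : TermFn F} {b₀ p₀ κ₁ a C C_T C' : ℝ} {σ : ℕ}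
    (hγ : 0 < γ) (hγ1 : γ ≤ 1) (hγe : Real.sqrt γ ≤ Real.exp (1 - p₀)) (hb : 0 < b₀) (hp : 0 ≤ p₀)
    (ha : 0 < a) (ha1 : a < 1) (hC : 0 ≤ C) (hCT : 0 ≤ C_T)
    (hdec : PintDecompTrivT D PT) (hLC : LocCover D κ₁ C') (hBV : LocBlockVolume D) (hLM : LocMatched D)
    (hTS : TermSizeTrivT D PT b₀ p₀ C_T κ₁) (hPC : PolymerCauchyMinAtTSlack D PT b₀ p₀ κ₁ a σ C) :
    GlobalSupRateTSlack D b₀ p₀ a σ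
      (max C' 0 * (C_T + C / (1 - (F.L : ℝ) ^ (a - 1)) + C / (1 - (F.L : ℝ)⁻¹))) := by
  have hLn : 1 ≤ F.L := F.hL.2.le
  have hθ : ∀ i, 0 ≤ θBal F.L γ b₀ p₀ i := fun i => (T3MinimiserStabilityReduction.θBal_pos hLn hγ hγ1 hb p₀ i).le
  exact (globalSupRateTSlack_iff_W D b₀ p₀ a σ _).2
    (globalSupRateWSlack_of_polymerWSlack (w := fun n => θBal F.L γ b₀ p₀ n ^ 2) hγ hγ1 hb (fun n => pow_nonneg (hθ n) 2)
      (fun n => pow_le_pow_left₀ (hθ (n + 1)) (θBal_succ_le hLn hγ hγ1 hγe hb.le hp n) 2) ha ha1 hC hCT hdec hLC hBV hLM hTS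
      ((polymerCauchyMinAtTSlack_iff_W D PT b₀ p₀ κ₁ a σ C).1 hPC))

/-- **THE TAIL OF STUB 3⁗ FROM THE SIX LOCAL ROWS** (PROVED): under the hypotheses of `globalSupRateTSlack_of_polymerSlack` and `7 ≤ σ`,
`∃ σ₀ C₀, 7 ≤ σ₀ ∧ 0 ≤ C₀ ∧ GlobalSupRateTSlack D b₀ p₀ a σ₀ C₀` = the registered `stub_globalTwoRunSlackFam`'s conclusion after `∃ p … ∃ π`, constant `K`-uniform and `≥ 0`.
[cite: King1986, Thm 3.4 (3.9) p.656; Balaban1985UV3, (43)-(46) pp.266-267] -/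
theorem globalTwoRunSlackTail_of_polymerSlack {D : AlphaDataT3 F γ} {PT : TermFn F} {b₀ p₀ κ₁ a C C_T C' : ℝ} {σ : ℕ}
    (hγ : 0 < γ) (hγ1 : γ ≤ 1) (hγe : Real.sqrt γ ≤ Real.exp (1 - p₀)) (hb : 0 < b₀) (hp : 0 ≤ p₀)
    (ha : 0 < a) (ha1 : a < 1) (hC : 0 ≤ C) (hCT : 0 ≤ C_T) (hσ : 7 ≤ σ)
    (hdec : PintDecompTrivT D PT) (hLC : LocCover D κ₁ C') (hBV : LocBlockVolume D) (hLM : LocMatched D)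
    (hTS : TermSizeTrivT D PT b₀ p₀ C_T κ₁) (hPC : PolymerCauchyMinAtTSlack D PT b₀ p₀ κ₁ a σ C) :
    ∃ (σ₀ : ℕ) (C₀ : ℝ), 7 ≤ σ₀ ∧ 0 ≤ C₀ ∧ GlobalSupRateTSlack D b₀ p₀ a σ₀ C₀ := by
  refine ⟨σ, _, hσ, ?_, globalSupRateTSlack_of_polymerSlack hγ hγ1 hγe hb hp ha ha1 hC hCT hdec hLC hBV hLM hTS hPC⟩
  have hL : (1 : ℝ) < (F.L : ℝ) := by exact_mod_cast F.hL.2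
  have hL0 : (0 : ℝ) < (F.L : ℝ) := by linarith
  have hra1 : (F.L : ℝ) ^ (a - 1) < 1 := Real.rpow_lt_one_of_one_lt_of_neg hL (by linarith)
  have hr01 : (F.L : ℝ)⁻¹ < 1 := inv_lt_one_of_one_lt₀ hL
  exact mul_nonneg (le_max_right _ _)
    (add_nonneg (add_nonneg hCT (div_nonneg hC (by linarith))) (div_nonneg hC (by linarith)))

end Summit.QuantumFields.YangMills.Theorems.GlobalSlackLocalToGlobal

end
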